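import Summits.BirchSwinnertonDyer.BirchSwinnertonDyer.Theorems.ErratumRoadFiveOpenInputIMCReduction
import Summits.BirchSwinnertonDyer.BirchSwinnertonDyer.Theorems.ErratumRoadFiveOpenInputIMCSplit
import Summits.BirchSwinnertonDyer.BirchSwinnertonDyer.Theorems.ErratumRoadFiveOpenInputIMCFromErratumFact
import HarnessLib

/-!
# Route `ErratumRoadFive`, crux `OpenInputIMC` (item 19061): the GLUE of the planner's five-child split
# (glue item stmt-BirchSwinnertonDyer-19284 `OpenInputIMCOfChildren`), and the by-citation road of the
# deciding child modulo the OPEN erratum fact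

Cell `bsd-stepL`; written by the planner (g23) for a prover hand to file
(`ledger propose --kind proof --target Summits/BirchSwinnertonDyer/BirchSwinnertonDyer/Theorems/ErratumRoadFiveOpenInputIMCSplitGlue.lean
 --file <this> --workitem stmt-BirchSwinnertonDyer-19284`). Bookkeeping only: composes imc-p1's landed
`openInputIMC_of_r1Locus_of_ramResidue_of_not_ram` (p418364, locus glue) with
`openInputIMC_r1Locus_of_coreFrames` (p417457, child R from H2 ∧ H3 + 11 published + 5 cited facts).
The second theorem records the CONDITIONAL road `erratumThm11_…_OPEN → IMCDivAtErratumDataAll` (child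
19270) from imc-p1's `imcDivIntCoreFrameAtErratumData_of_erratumThm11_OPEN` (FromErratumFact.lean); it
closes nothing (the OPEN fact is an explicitly labelled unrefereed hypothesis). THEOREMS ONLY; no sorry.
-/

namespace Summit.BirchSwinnertonDyer.BirchSwinnertonDyer.Theorems

/-- **Glue of the five-child split of item 19061** (closes glue item 19284):
H3 → (open input on (ram) off the erratum locus) → H2 → (open input on ¬(ram)) → (published facts) → `OpenInputIMC`. [folklore] -/
theorem openInputIMCOfChildren_holds :
    Summit.BirchSwinnertonDyer.BirchSwinnertonDyer.Theses.ErratumRoadFive.OpenInputIMCOfChildren :=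
  fun h3 hRam h2 hOff hF ↦ by
    obtain ⟨hGZ86, hGZK, hSk, hnf, hCST, hFH, hMaz, hGZ, hKo, hB, hHL, hPTs, hPT, hPT2, hEP, hcd⟩ := hF
    exact openInputIMC_of_r1Locus_of_ramResidue_of_not_ram
      (openInputIMC_r1Locus_of_coreFrames hGZ86 hGZK hSk hnf hCST hFH hMaz hGZ hKo hB hHL hPTs hPT hPT2
        hEP hcd h2 h3) hRam hOff

/-- **The deciding child from the OPEN erratum fact** (CONDITIONAL; closes nothing): Castella's erratum
Thm. 1.1 = arXiv:2409.01360 Thm. 3.1, typed `_OPEN` by imc-t1 (p417695), gives `IMCDivAtErratumDataAll`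
(item 19270) at every pair. [claim: Castella2018Erratum, status: under-review] -/
theorem imcDivAtErratumDataAll_of_erratumThm11_OPEN
    (h : Literature.NumberTheory.EllipticCurves.Castella2018.erratumThm11_exists_isBDPLFunction_isTorsion_charIdeal_eq_OPEN) :
    Summit.BirchSwinnertonDyer.BirchSwinnertonDyer.Theses.ErratumRoadFive.IMCDivAtErratumDataAll :=
  fun W _ _ p _ ↦ imcDivIntCoreFrameAtErratumData_of_erratumThm11_OPEN (W := W) (p := p) h

end Summit.BirchSwinnertonDyer.BirchSwinnertonDyer.Theorems
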